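import Mathlib
import Literature.AlgebraicGeometry.Resolution.CobordantGame
import Summits.ResolutionOfSingularities.ResolutionOfSingularities.Theorems.WeightedInvariantLocalWeightedDropGradedSliceRank

/-!
# `WeightedInvariant.LocalWeightedDrop`: `Z^p + y^p` IS graded-won with rank `1`, for every grading lattice

Route `ResolutionOfSingularities/WeightedInvariant`, crux `LocalWeightedDrop` (stmt-ResolutionOfSingularities-8899).
[OURS · L1 W4.3] — CHAIN w43 SEAT TABLE v7 row res-type-060 «idea-1's graded slices»; third piece of the kernel probe of R3-T3
`gradedWonBy_slice_iff` (ideator res-L1-w43-idea-1, Sketch v3 §5).  Companions: `…GradedSliceRank` (the umbrella specimen, whose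
slice is `Z^p + y^p`; tools), `…GradedSliceNoOneMoveWin` (`not_gradedWonBy_zero_addPow`: no graded ONE-move win when the slice
grading separates `y` from `s` and `Z`; the refutation of R3-T3 as typed).  Nothing here is a statement of the manuscript under
review on ladder RESOLUTION; not a verdict on card A.  AI proof, weaker than expert review.

* `gradedWonBy_one_addPow` — for EVERY field of characteristic `p` and EVERY lattice `L ⊆ ℤ³`, `GradedWonBy 1 3 L (Z^p + y^p)`:
  the identity move with centre `{Z = y = 0}` (weights `(0,1,1)`) has singular successors only at the exceptional points with
  `c_Z^p + c_y^p = 0`, hence `c_Z c_y ≠ 0`; there the successor is `Z'^p + y'^p` and BOTH translated coordinates have trivial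
  character in the propagated lattice (`e_{Z'}, e_{y'} ∈ succLattice L w c`), so the coordinate change `Z' ↦ Z' − y'` IS graded,
  `(Z' − y')^p + y'^p = Z'^p` (Frobenius), and the divisorial move on `Z'` has no singular successor (`(c + Z')^p` has constant
  term `c^p ≠ 0`).  With `not_gradedWonBy_zero_addPow`: for lattices separating `y` from `s`, `Z` the graded rank of `(Z + y)^p`
  is EXACTLY `1` — the slice of the umbrella specimen costs exactly the one extra move that kills its grading; the rank-free form
  of R3-T3 («`g` graded-won ↔ slice graded-won») survives the specimen.
-/

set_option linter.dupNamespace false -- mandated namespace of this single-conjunct summit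
set_option autoImplicit false

namespace Summit.ResolutionOfSingularities.ResolutionOfSingularities.Theorems

namespace GradedGame

open MvPowerSeries
open Literature.AlgebraicGeometry.Resolution

variable {k : Type} [Field k]

section AddPow

variable (p : ℕ) [hp : Fact p.Prime]

/-- **… BUT THE SLICE IS GRADED-WON WITH RANK `1`, for EVERY grading lattice** (every field of characteristic `p`): on
`Z^p + y^p ∈ k[[s, Z, y]]` the identity move with weights `(0,1,1)` (centre `{Z = y = 0}`) has singular successors only at the
exceptional points `(c_Z, c_y)` with `c_Z^p + c_y^p = 0`, hence `c_Z c_y ≠ 0`; there the successor is `Z'^p + y'^p` and BOTH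
translated coordinates have trivial character in the propagated lattice (`e_{Z'}, e_{y'} ∈ succLattice`), so the coordinate
change `Z' ↦ Z' − y'` IS graded and the divisorial move on `Z'` wins outright (`(Z' − y')^p + y'^p = Z'^p`, successors
`(c + Z')^p` are units).  With `not_gradedWonBy_zero_addPow`: for lattices separating `y` from `s` and `Z` the graded rank of
`(Z + y)^p` is EXACTLY `1` — the slice of the umbrella specimen costs exactly one extra move (the one that kills the grading);
the rank-free form of R3-T3 survives the specimen. [OURS · L1 W4.3] -/
theorem gradedWonBy_one_addPow [CharP k p] (L : AddSubgroup (Fin 3 → ℤ)) :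
    GradedWonBy 1 3 L (X 1 ^ p + X 2 ^ p : MvPowerSeries (Fin 3) k) := by
  classical
  have hp0 : 0 < p := hp.out.pos
  haveI : CharP (MvPowerSeries (Fin 4) k) p := charP_of_injective_ringHom MvPowerSeries.C_injective p
  haveI : CharP (MvPowerSeries (Fin 5) k) p := charP_of_injective_ringHom MvPowerSeries.C_injective p
  rw [gradedWonBy_iff]
  refine ⟨fun i => X i, ![0, 1, 1], isLGradedMove_X L _ ⟨1, by simp⟩, ?_⟩
  rintro c a g ⟨⟨i, hwi, hci⟩, hfac, hndvd, hc0, -⟩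
  refine ⟨0, zero_lt_one, ?_⟩
  -- the first move: `h(chart_c) = σ^p · G`, `G = (c_Z + Z')^p + (c_y + y')^p`
  have hC := hasSubst_cruxChart (k := k) ![0, 1, 1] c
  set G : MvPowerSeries (Fin 4) k := (C (c 1) + X 2) ^ p + (C (c 2) + X 3) ^ p with hG
  have hself : subst (fun i : Fin 3 => (X i : MvPowerSeries (Fin 3) k)) (X 1 ^ p + X 2 ^ p : MvPowerSeries (Fin 3) k) =
      (X 1 ^ p + X 2 ^ p : MvPowerSeries (Fin 3) k) := by
    rw [show (fun i : Fin 3 => (X i : MvPowerSeries (Fin 3) k)) = X from rfl, subst_self]; rfl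
  have hchart : subst (CobordantGame.cruxChart k ![0, 1, 1] c) (subst (fun i : Fin 3 => (X i : MvPowerSeries (Fin 3) k))
      (X 1 ^ p + X 2 ^ p : MvPowerSeries (Fin 3) k)) = X 0 ^ p * G := by
    rw [hself, subst_add hC, subst_pow hC, subst_pow hC, subst_X hC, subst_X hC,
      cruxChart_of_pos _ _ 1 (by simp), cruxChart_of_pos _ _ 2 (by simp)]
    simp only [Matrix.cons_val_one, Matrix.head_cons, Matrix.cons_val_zero, Matrix.cons_val_two, Matrix.tail_cons,
      pow_one]
    have h1 : (1 : Fin 3).succ = (2 : Fin 4) := rfl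
    have h2 : (2 : Fin 3).succ = (3 : Fin 4) := rfl
    rw [h1, h2, hG]
    simp only [mul_pow]
    ring
  rw [hchart] at hfac
  have hGexp : G = C (c 1 ^ p + c 2 ^ p) + (monomial (Finsupp.single 2 p) 1 + monomial (Finsupp.single 3 p) 1) := by
    rw [hG, add_pow_char, add_pow_char, ← map_pow, ← map_pow, X_pow_eq, X_pow_eq, map_add]
    ring
  have h20 : (Finsupp.single 2 p : Fin 4 →₀ ℕ) ≠ 0 := by simp [hp0.ne']
  have h23 : (Finsupp.single 2 p : Fin 4 →₀ ℕ) ≠ Finsupp.single 3 p := by simp [Finsupp.single_eq_single_iff, hp0.ne']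
  have hG2 : coeff (Finsupp.single 2 p) G = 1 := by
    rw [hGexp]
    simp only [map_add, coeff_C, coeff_monomial, h20, h23, if_false, if_true]
    ring
  have hG0 : constantCoeff G = c 1 ^ p + c 2 ^ p := by
    simp [hG, map_add, map_pow, constantCoeff_X, constantCoeff_C]
  have hGnd : ¬ X 0 ∣ G := by
    rw [X_dvd_iff]
    push Not
    exact ⟨Finsupp.single 2 p, by simp, by rw [hG2]; exact one_ne_zero⟩
  obtain ⟨-, hGg⟩ := eq_of_X_pow_mul_eq hfac hGnd hndvd
  rw [← hGg, hG0] at hc0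
  -- `c_Z^p + c_y^p = 0` with `(c_Z, c_y) ≠ 0` forces `c_Z ≠ 0` and `c_y ≠ 0`
  have hc1ne : c 1 ≠ 0 := by
    intro h1
    rw [h1, zero_pow hp0.ne', zero_add] at hc0
    have h2 : c 2 = 0 := (pow_eq_zero_iff hp0.ne').mp hc0
    fin_cases i <;> simp_all
  have hc2ne : c 2 ≠ 0 := by
    intro h2
    rw [h2, zero_pow hp0.ne', add_zero] at hc0
    have h1 : c 1 = 0 := (pow_eq_zero_iff hp0.ne').mp hc0
    fin_cases i <;> simp_all
  have hg : g = X 2 ^ p + X 3 ^ p := by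
    rw [← hGg, hGexp, hc0, map_zero, zero_add, X_pow_eq, X_pow_eq]
  -- both translated coordinates have trivial character in the propagated lattice
  have he2 : (Pi.single 2 1 : Fin 4 → ℤ) ∈ succLattice L ![0, 1, 1] c :=
    AddSubgroup.subset_closure (Or.inr ⟨1, hc1ne, by simp, rfl⟩)
  have he3 : (Pi.single 3 1 : Fin 4 → ℤ) ∈ succLattice L ![0, 1, 1] c :=
    AddSubgroup.subset_closure (Or.inr ⟨2, hc2ne, by simp, rfl⟩)
  -- the second move: `θ'' = (σ, s, Z' − y', y')`, divisorial weight on `Z'`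
  rw [gradedWonBy_zero_iff]
  let θ'' : Fin 4 → MvPowerSeries (Fin 4) k := ![X 0, X 1, X 2 - X 3, X 3]
  have hθ0e : θ'' 0 = X 0 := rfl
  have hθ1e : θ'' 1 = X 1 := rfl
  have hθ2e : θ'' 2 = X 2 - X 3 := rfl
  have hθ3e : θ'' 3 = X 3 := rfl
  have hθc : ∀ j, constantCoeff (θ'' j) = 0 := by
    intro j
    fin_cases j
    · simp [hθ0e, constantCoeff_X]
    · simp [hθ1e, constantCoeff_X]
    · simp [hθ2e, constantCoeff_X]
    · simp [hθ3e, constantCoeff_X]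
  have hθs : HasSubst θ'' := hasSubst_of_constantCoeff_zero hθc
  -- entries of the linear part
  have hlin : ∀ i j : Fin 4, coeff (Finsupp.single j 1) (θ'' i) =
      if i = j then 1 else if i = 2 ∧ j = 3 then -1 else 0 := by
    intro i j
    fin_cases i <;> fin_cases j <;>
      simp [hθ0e, hθ1e, hθ2e, hθ3e, coeff_X, map_sub, Finsupp.single_eq_single_iff]
  refine ⟨θ'', ![0, 0, 1, 0], ⟨⟨hθc, ?_, ⟨2, by simp⟩⟩, ?_⟩, ?_⟩
  · -- determinant: upper triangular with unit diagonal
    have htri : Matrix.BlockTriangular (Matrix.of fun i j => coeff (Finsupp.single j 1) (θ'' i)) id := by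
      intro i j hij
      rw [Matrix.of_apply, hlin]
      have hne : i ≠ j := fun h => by simp [h] at hij
      rw [if_neg hne, if_neg]
      rintro ⟨rfl, rfl⟩
      exact absurd hij (by decide)
    rw [Matrix.det_of_upperTriangular htri, Fin.prod_univ_four]
    simp only [Matrix.of_apply, hlin, if_true]
    norm_num
  · -- gradedness of `θ''`
    have hθX : ∀ j : Fin 4, j ≠ 2 → θ'' j = X j := by
      intro j hj
      fin_cases j
      · rfl
      · rfl
      · exact absurd rfl hj
      · rfl
    intro j e he
    by_cases hj2 : j = 2
    · subst hj2
      rw [hθ2e, map_sub, coeff_X, coeff_X] at he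
      by_cases hE2 : e = Finsupp.single 2 1
      · subst hE2
        rw [expVec_single, Nat.cast_one, sub_self]
        exact AddSubgroup.zero_mem _
      · by_cases hE3 : e = Finsupp.single 3 1
        · subst hE3
          rw [expVec_single, Nat.cast_one]
          exact AddSubgroup.sub_mem _ he3 he2
        · exact absurd (by rw [if_neg hE2, if_neg hE3, sub_zero]) he
    · have hej : e = Finsupp.single j 1 := by
        rw [hθX j hj2, coeff_X] at he
        by_contra hne
        exact he (if_neg hne)
      subst hej
      rw [expVec_single, Nat.cast_one, sub_self]
      exact AddSubgroup.zero_mem _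
  · -- no singular successor: `(Z' − y')^p + y'^p = Z'^p`, and `(c + Z')^p` is a unit at `c ≠ 0`
    rintro c' a' g' ⟨⟨i', hwi', hci'⟩, hfac', hndvd', hc0', -⟩
    have hC' := hasSubst_cruxChart (k := k) ![0, 0, 1, 0] c'
    have hsub' : subst θ'' g = X 2 ^ p := by
      rw [hg, subst_add hθs, subst_pow hθs, subst_pow hθs, subst_X hθs, subst_X hθs, hθ2e, hθ3e, sub_pow_char]
      ring
    rw [hsub', subst_pow hC', subst_X hC', cruxChart_of_pos _ _ 2 (by simp)] at hfac'
    simp only [Matrix.cons_val_two, Matrix.tail_cons, Matrix.head_cons, pow_one] at hfac'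
    have h3 : (2 : Fin 4).succ = (3 : Fin 5) := rfl
    rw [h3, mul_pow] at hfac'
    set G' : MvPowerSeries (Fin 5) k := (C (c' 2) + X 3) ^ p with hG'
    have hG'exp : G' = C (c' 2 ^ p) + monomial (Finsupp.single 3 p) 1 := by
      rw [hG', add_pow_char, ← map_pow, X_pow_eq]
    have h30 : (Finsupp.single 3 p : Fin 5 →₀ ℕ) ≠ 0 := by simp [hp0.ne']
    have hG'3 : coeff (Finsupp.single 3 p) G' = 1 := by
      rw [hG'exp, map_add, coeff_C, coeff_monomial, if_neg h30, if_pos rfl, zero_add]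
    have hG'nd : ¬ X 0 ∣ G' := by
      rw [X_dvd_iff]
      push Not
      exact ⟨Finsupp.single 3 p, by simp, by rw [hG'3]; exact one_ne_zero⟩
    obtain ⟨-, hGg'⟩ := eq_of_X_pow_mul_eq hfac' hG'nd hndvd'
    rw [← hGg', hG'exp, map_add, constantCoeff_C] at hc0'
    have hmono : constantCoeff (monomial (Finsupp.single 3 p) (1 : k) : MvPowerSeries (Fin 5) k) = 0 := by
      rw [← coeff_zero_eq_constantCoeff_apply, coeff_monomial, if_neg h30.symm]
    rw [hmono, add_zero] at hc0'
    have hc'2 : c' 2 = 0 := (pow_eq_zero_iff hp0.ne').mp hc0'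
    fin_cases i' <;> simp_all

end AddPow

end GradedGame

end Summit.ResolutionOfSingularities.ResolutionOfSingularities.Theorems
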